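import Literature.NumberTheory.Automorphic.Liu2021.AppendixC.HeckeImage
import Literature.RingTheory.SimpleModule.SemisimpleOfFaithfulModule
import Literature.RingTheory.SimpleModule.SemisimpleBaseChangeDescent
import HarnessLib

/-!
# [Liu 2021, p. 133 (D.3)] the image of the Hecke algebra in `End⁰(A_K)` is SEMISIMPLE, granted `H¹_ét(A_K)` is a semisimple Hecke module (d6 DH2b, door (β))

Topic `NumberTheory/Automorphic/Liu2021/AppendixC`; namespace `Literature.NumberTheory.Automorphic.Liu2021.AppendixC.Sec42Data.HeckeTranslates`.
THEOREMS ONLY (no definition, no named fact, no instance, no `sorry`).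

Print, [Liu2021] p. 133: the homomorphism `C_c^∞(K\G(𝔸^∞)/K, ℚ) → End(A_K)_ℚ` and «under the canonical isomorphism in Lemma 2.4 (1), we have
isomorphisms `H¹_B(A_K^st, ℂ) ≃ ⊕_{π^∞ ∈ C_V^st} H¹_B(Sh(G,h)_K, ℂ)[(π^∞)^K]` … of `C_c^∞(K\G(𝔸^∞)/K, ℚ)`-modules» (D.3): the level-`K` cohomology is a
direct sum of isotypic pieces, i.e. a SEMISIMPLE Hecke module, and the decomposition `A_K ∼ A_K^st × A_K^end` is cut out by central idempotents of
the (therefore semisimple) image ★ `heckeImage`.  This file proves the algebra behind «therefore»: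

* `isSemisimpleRing_heckeImage_of_isSemisimpleModule (ℓ)` — if `V_ℓ A_K` is a semisimple module over the `ℚ_ℓ`-algebra
  `Sℓ := ℚ_ℓ[V_ℓ^ℚ [KgK] : g] ⊆ End_{ℚ_ℓ}(V_ℓ A_K)` generated by the `ℓ`-adic realisations of the Hecke endomorphisms, then `heckeImage` is a
  semisimple ring.  Proof: `Sℓ` is semisimple (faithful semisimple module of finite type, ★ `SemisimpleOfFaithfulModule`, Lam (9.11));
  `ℚ_ℓ ⊗_ℚ heckeImage ≅ Sℓ` (the realisation `c ⊗ x ↦ c · V_ℓ^ℚ x` is injective by Mumford §19 Thm. 3 in its `ℚ_ℓ ⊗` form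
  ★ `linearIndependent_rationalTateAction`, and onto `Sℓ` by ★ `adjoin_rationalTateAction_heckeEnd_eq`); descend along `ℚ → ℚ_ℓ`
  (★ `SemisimpleBaseChangeDescent`, trace form, characteristic `0`).
* `isSemisimpleRing_padicTensor_heckeImage_iff` — the intermediate statement `ℚ_ℓ ⊗_ℚ heckeImage` semisimple ↔ `heckeImage` semisimple.

The hypothesis is the cell's S1 clause (3) typed on the homology side at one prime `ℓ` (`IsSemisimpleModule ↥Sℓ (V_ℓ A_K)`); the Hecke operators
`[KgK]` on `H¹_ét(A_K) ≅ H¹_ét(A_∞)^K` are the transposes of the generators of `Sℓ` (★ `toTower_dualMap_rationalTateAction_heckeEnd`).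

DICTIONARY LINE (cell `hodgecm-mathlib`, crux `HLiu418` = stmt-HodgeConjecture-24832, d6 HOME card S2′, census `CENSUS-DH1-DH2.A-p09g13.md` §DH2
door (β)): next is DH2c (central idempotents of the semisimple `ℚ`-algebra `heckeImage` cut the blocks; the honest projector `u = d • ε`).  The file
moves no book (HC_CM is proved only modulo the 7 printed citations until rung 0 closes).

## References
* [Liu2021] Y. Liu, *Fourier–Jacobi cycles and arithmetic relative trace formula*, Camb. J. Math. 9 (2021): p. 133 (before and at (D.3), FJcycle.tex
  l. 5463–5470).
* [MumfordAV1970] D. Mumford, *Abelian Varieties*, §19 Thm. 3 (`ℚ_ℓ ⊗ End⁰(A) → End V_ℓ A` injective) and Cor. 1–2.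
* [Lam2001FirstCourse] T. Y. Lam, *A First Course in Noncommutative Rings*, §9 (9.11) p. 146.
* [Pierce1982] R. S. Pierce, *Associative Algebras*, §10.6 Cor., §10.7 Cor. b.
-/

set_option autoImplicit false

noncomputable section

open CategoryTheory NumberField Function MulAction
open scoped TensorProduct

namespace Literature.NumberTheory.Automorphic.Liu2021.AppendixC

open Literature.AlgebraicGeometry.Motives (AbelianVariety)
open Literature.AlgebraicGeometry.Motives.AbelianVariety (endAlgebra rationalTateAction rationalTateAction_algebraMap rationalTateAction_injective
  linearIndependent_rationalTateAction)

variable {F E : Type} [Field F] [NumberField F] [IsTotallyReal F] [Field E] [NumberField E] [Algebra F E]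
  [IsTotallyComplex E] [Algebra.IsQuadraticExtension F E]
variable {P5 : PropC5Data F E} {isotropicAt : ℕ → Prop}

namespace Sec42Data.HeckeTranslates

variable {C : Sec42Data P5 isotropicAt} (T : C.HeckeTranslates) (ℓ : ℕ) [Fact ℓ.Prime]

/-- `ℓ ≠ 0` in a number field. [folklore] -/
private theorem natCast_ne_zero' {L : Type*} [Field L] [NumberField L] : (ℓ : L) ≠ 0 := Nat.cast_ne_zero.2 (Fact.out : ℓ.Prime).ne_zero

/-- **`ℚ_ℓ ⊗_ℚ heckeImage` is semisimple iff `heckeImage` is** (`heckeImage` is a finite-dimensional `ℚ`-algebra; base change and descent of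
semisimplicity in characteristic `0`). [cite: Pierce1982, §10.6 Corollary (p. 189) and §10.7 Corollary b (p. 191)] [cite: Liu2021, p. 133 (before (D.3))] -/
theorem isSemisimpleRing_padicTensor_heckeImage_iff (hD : T.IsogenyDescent) (K : C5.SmallLevel C.S.K₀) :
    IsSemisimpleRing (ℚ_[ℓ] ⊗[ℚ] ↥(T.heckeImage hD K)) ↔ IsSemisimpleRing ↥(T.heckeImage hD K) := by
  haveI := T.module_finite_heckeImage hD K
  exact Literature.RingTheory.SimpleModule.isSemisimpleRing_baseChange_iff ℚ _ ℚ_[ℓ]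

/-- **The algebra behind door (β)**: if the `ℚ_ℓ`-subalgebra `Sℓ ⊆ End_{ℚ_ℓ}(V_ℓ A_K)` generated by the realisations `V_ℓ^ℚ [KgK]` of the
Hecke endomorphisms is a semisimple ring, then so is `heckeImage` — because `ℚ_ℓ ⊗_ℚ heckeImage ≅ Sℓ` (the realisation `c ⊗ x ↦ c · V_ℓ^ℚ x` is
injective by Mumford §19 Thm. 3 in its `ℚ_ℓ ⊗` form and onto `Sℓ`) and semisimplicity descends along `ℚ → ℚ_ℓ`.
[cite: Liu2021, p. 133 (before and at (D.3))] [cite: MumfordAV1970, §19 Thm. 3] [cite: Pierce1982, §10.6 Corollary (p. 189) and §10.7 Corollary b (p. 191)] -/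
theorem isSemisimpleRing_heckeImage_of_isSemisimpleRing_adjoin (hD : T.IsogenyDescent) (K : C5.SmallLevel C.S.K₀)
    (hS : IsSemisimpleRing
      ↥(Algebra.adjoin ℚ_[ℓ] (Set.range fun g : C.G => rationalTateAction (C.A K) ℓ (T.heckeEnd hD K g)))) :
    IsSemisimpleRing ↥(T.heckeImage hD K) := by
  classical
  -- notation
  set V := (C.A K).rationalTateModule ℓ with hVdef
  set Tq : Subalgebra ℚ (C.A K).endAlgebra := T.heckeImage hD K with hTq
  set Sℓ : Subalgebra ℚ_[ℓ] (Module.End ℚ_[ℓ] V) :=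
    Algebra.adjoin ℚ_[ℓ] (Set.range fun g : C.G => rationalTateAction (C.A K) ℓ (T.heckeEnd hD K g)) with hSℓ
  have hℓE : (ℓ : E) ≠ 0 := natCast_ne_zero' ℓ
  haveI : Module.Finite ℚ ↥Tq := T.module_finite_heckeImage hD K
  haveI : IsSemisimpleRing ↥Sℓ := hS
  -- the realisation `θ : ℚ_ℓ ⊗_ℚ Tq → End V`, `c ⊗ x ↦ c • V_ℓ^ℚ x`, an isomorphism onto `Sℓ`
  letI algQ : Algebra ℚ (Module.End ℚ_[ℓ] V) :=
    ((algebraMap ℚ_[ℓ] (Module.End ℚ_[ℓ] V)).comp (algebraMap ℚ ℚ_[ℓ])).toAlgebra' fun q x =>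
      Algebra.commutes (algebraMap ℚ ℚ_[ℓ] q) x
  haveI : IsScalarTower ℚ ℚ_[ℓ] (Module.End ℚ_[ℓ] V) := IsScalarTower.of_algebraMap_eq fun _ => rfl
  let ρ : ↥Tq →ₐ[ℚ] Module.End ℚ_[ℓ] V :=
    { (rationalTateAction (C.A K) ℓ).comp Tq.val.toRingHom with
      commutes' := fun q => by
        change rationalTateAction (C.A K) ℓ (algebraMap ℚ (C.A K).endAlgebra q) = _
        rw [rationalTateAction_algebraMap]
        rfl }
  have hρ : ∀ x : ↥Tq, ρ x = rationalTateAction (C.A K) ℓ (x : (C.A K).endAlgebra) := fun _ => rfl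
  let θ : ℚ_[ℓ] ⊗[ℚ] ↥Tq →ₐ[ℚ_[ℓ]] Module.End ℚ_[ℓ] V :=
    Algebra.TensorProduct.lift (Algebra.ofId ℚ_[ℓ] (Module.End ℚ_[ℓ] V)) ρ fun c x => Algebra.commutes c (ρ x)
  have hθ : ∀ (c : ℚ_[ℓ]) (x : ↥Tq), θ (c ⊗ₜ[ℚ] x) = c • rationalTateAction (C.A K) ℓ (x : (C.A K).endAlgebra) := by
    intro c x
    change Algebra.TensorProduct.lift _ _ _ (c ⊗ₜ[ℚ] x) = _
    rw [Algebra.TensorProduct.lift_tmul, ← hρ, Algebra.ofId_apply, Algebra.smul_def]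
  -- the range of `θ` is `Sℓ`
  have hrange : θ.range = Sℓ := by
    refine le_antisymm ?_ ?_
    · intro y hy
      obtain ⟨z, rfl⟩ := (AlgHom.mem_range θ).1 hy
      clear hy
      induction z using TensorProduct.induction_on with
      | zero => rw [map_zero]; exact Sℓ.zero_mem
      | tmul c x =>
        rw [hθ, hSℓ, T.adjoin_rationalTateAction_heckeEnd_eq ℓ hD K]
        refine Subalgebra.smul_mem _ ?_ c
        exact Algebra.subset_adjoin ⟨(x : (C.A K).endAlgebra), x.2, rfl⟩
      | add z w hz hw => rw [map_add]; exact Sℓ.add_mem hz hw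
    · refine Algebra.adjoin_le ?_
      rintro _ ⟨g, rfl⟩
      refine (AlgHom.mem_range θ).2 ⟨(1 : ℚ_[ℓ]) ⊗ₜ[ℚ] ⟨T.heckeEnd hD K g, T.heckeEnd_mem_heckeImage hD K g⟩, ?_⟩
      rw [hθ, one_smul]
  -- `θ` is injective: a `ℚ`-basis of `Tq` acts `ℚ_ℓ`-linearly independently (Mumford §19 Thm. 3, `ℚ_ℓ ⊗` form)
  have hinj : Function.Injective θ := by
    let b := Module.finBasis ℚ ↥Tq
    -- (the `AddCommGroup`/`Module` instances on the `def` `endAlgebra` are threaded by hand: instance search does not bridge its two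
    -- `AddCommMonoid` paths, cf. `AbelianVarietyEndAlgebraInstances`)
    have hbE : LinearIndependent ℚ fun i => (b i : (C.A K).endAlgebra) :=
      @LinearIndependent.map' _ ℚ ↥Tq (C.A K).endAlgebra b _ _
        (Literature.AlgebraicGeometry.Motives.AbelianVariety.endAlgebra.instRing (C.A K)).toAddCommGroup _ Algebra.toModule
        b.linearIndependent Tq.val.toLinearMap (by
          refine (Submodule.eq_bot_iff _).2 fun x hx => ?_
          exact Subtype.ext hx)
    have hli : LinearIndependent ℚ_[ℓ] fun i => rationalTateAction (C.A K) ℓ (b i : (C.A K).endAlgebra) :=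
      linearIndependent_rationalTateAction (A := C.A K) (ℓ := ℓ) hℓE hbE
    -- `θ (1 ⊗ b i) = V_ℓ^ℚ (b i)`
    let bT := Algebra.TensorProduct.basis ℚ_[ℓ] b
    have hθb : (fun i => θ (bT i)) = fun i => rationalTateAction (C.A K) ℓ (b i : (C.A K).endAlgebra) := by
      funext i
      rw [Algebra.TensorProduct.basis_apply, hθ, one_smul]
    have hli' : LinearIndependent ℚ_[ℓ] (⇑θ.toLinearMap ∘ ⇑bT) := by
      change LinearIndependent ℚ_[ℓ] fun i => θ (bT i)
      rw [hθb]
      exact hli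
    have key : ∀ z, θ z = Finsupp.linearCombination ℚ_[ℓ] (⇑θ.toLinearMap ∘ ⇑bT) (bT.repr z) := fun z => by
      rw [← Finsupp.apply_linearCombination, Module.Basis.linearCombination_repr]
      rfl
    intro z w hzw
    rw [key, key] at hzw
    exact bT.repr.injective (hli' hzw)
  -- hence `ℚ_ℓ ⊗_ℚ Tq ≃ Sℓ` as rings, and `ℚ_ℓ ⊗_ℚ Tq` is semisimple
  have e : ℚ_[ℓ] ⊗[ℚ] ↥Tq ≃ₐ[ℚ_[ℓ]] ↥Sℓ := (AlgEquiv.ofInjective θ hinj).trans (Subalgebra.equivOfEq _ _ hrange)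
  haveI : IsSemisimpleRing (ℚ_[ℓ] ⊗[ℚ] ↥Tq) := e.symm.toRingEquiv.isSemisimpleRing
  -- descent along `ℚ → ℚ_ℓ`
  exact Literature.RingTheory.SimpleModule.isSemisimpleRing_of_isSemisimpleRing_baseChange ℚ (↥Tq) ℚ_[ℓ]

/-- **Transport to the cohomology side** (`H¹_ét(A_K) = (V_ℓ A_K)^∨`, finite-dimensional duality): the `ℚ_ℓ`-algebra generated by the operators
`V_ℓ^ℚ [KgK]` on `V_ℓ A_K` is anti-isomorphic, by the transpose, to the one generated by the Hecke operators `ᵗ(V_ℓ^ℚ [KgK]) = [KgK]` on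
`H¹_ét(A_K)`; so if `H¹_ét(A_K)` is a semisimple module over the latter, the former is a semisimple ring (Lam (9.11) + `IsSemisimpleRing Rᵐᵒᵖ ↔
IsSemisimpleRing R`). [cite: Lam2001FirstCourse, §9 Prop. (9.11) p. 146] [cite: Liu2021, p. 133 (before and at (D.3)) and §4.2 (FJcycle.tex l. 2074, 2154–2160)] -/
theorem isSemisimpleRing_adjoin_rationalTateAction_of_isSemisimpleModule_etaleH1 (hD : T.IsogenyDescent) (K : C5.SmallLevel C.S.K₀)
    (hss : IsSemisimpleModule
      ↥(Algebra.adjoin ℚ_[ℓ] (Set.range fun g : C.G => (rationalTateAction (C.A K) ℓ (T.heckeEnd hD K g)).dualMap))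
      (C.etaleH1 ℓ K)) :
    IsSemisimpleRing ↥(Algebra.adjoin ℚ_[ℓ] (Set.range fun g : C.G => rationalTateAction (C.A K) ℓ (T.heckeEnd hD K g))) := by
  classical
  set V := (C.A K).rationalTateModule ℓ with hVdef
  set Sℓ : Subalgebra ℚ_[ℓ] (Module.End ℚ_[ℓ] V) :=
    Algebra.adjoin ℚ_[ℓ] (Set.range fun g : C.G => rationalTateAction (C.A K) ℓ (T.heckeEnd hD K g)) with hSℓ
  set St : Subalgebra ℚ_[ℓ] (Module.End ℚ_[ℓ] (C.etaleH1 ℓ K)) :=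
    Algebra.adjoin ℚ_[ℓ] (Set.range fun g : C.G => (rationalTateAction (C.A K) ℓ (T.heckeEnd hD K g)).dualMap) with hSt
  have hℓE : (ℓ : E) ≠ 0 := natCast_ne_zero' ℓ
  haveI : Module.Finite ℚ_[ℓ] V := by
    haveI := Literature.AlgebraicGeometry.Motives.AbelianVariety.module_finite_tateModule_of_cast_ne_zero (C.A K) ℓ hℓE
    change Module.Finite ℚ_[ℓ] (ℚ_[ℓ] ⊗[ℤ_[ℓ]] (C.A K).tateModule ℓ)
    infer_instance
  haveI : Module.Finite ℚ_[ℓ] (C.etaleH1 ℓ K) := by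
    change Module.Finite ℚ_[ℓ] (Module.Dual ℚ_[ℓ] V)
    infer_instance
  -- the dual-side algebra is a semisimple ring (faithful semisimple module of finite type)
  haveI : IsSemisimpleRing ↥St := Literature.RingTheory.SimpleModule.isSemisimpleRing_of_isSemisimpleModule St
  -- the transpose, as an algebra homomorphism into the opposite algebra
  let d : Module.End ℚ_[ℓ] V →ₐ[ℚ_[ℓ]] (Module.End ℚ_[ℓ] (C.etaleH1 ℓ K))ᵐᵒᵖ :=
    { toFun := fun f => MulOpposite.op f.dualMap
      map_one' := congrArg MulOpposite.op LinearMap.dualMap_id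
      map_mul' := fun f g => by
        rw [← MulOpposite.op_mul, Module.End.mul_eq_comp, ← LinearMap.dualMap_comp_dualMap]
        rfl
      map_zero' := by
        rw [← MulOpposite.op_zero]
        congr 1
        ext φ v
        simp [LinearMap.dualMap_apply]
      map_add' := fun f g => by
        rw [← MulOpposite.op_add]
        congr 1
        ext φ v
        simp [LinearMap.dualMap_apply]
      commutes' := fun c => by
        rw [MulOpposite.algebraMap_apply]
        congr 1
        ext φ v
        simp [LinearMap.dualMap_apply, Algebra.algebraMap_eq_smul_one] }
  have hd : ∀ f : Module.End ℚ_[ℓ] V, d f = MulOpposite.op f.dualMap := fun _ => rfl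
  -- `d` is injective (the dual separates points)
  have hdinj : Function.Injective d := by
    intro f g hfg
    have h1 : f.dualMap = g.dualMap := MulOpposite.op_injective (by rw [← hd, ← hd, hfg])
    refine LinearMap.ext fun v => ?_
    rw [← sub_eq_zero]
    refine (Module.forall_dual_apply_eq_zero_iff ℚ_[ℓ] (f v - g v)).1 fun φ => ?_
    have h2 := LinearMap.congr_fun (LinearMap.congr_fun h1 φ) v
    rw [LinearMap.dualMap_apply, LinearMap.dualMap_apply] at h2
    rw [map_sub, h2, sub_self]
  -- `Sℓ.map d = St.op`
  have hmap : Sℓ.map d = St.op := by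
    rw [hSℓ, AlgHom.map_adjoin, hSt, Subalgebra.op_adjoin, ← Set.range_comp]
    congr 1
    ext y
    simp only [Set.mem_preimage, Set.mem_range, Function.comp_apply, hd]
    constructor
    · rintro ⟨g, rfl⟩
      exact ⟨g, rfl⟩
    · rintro ⟨g, hg⟩
      exact ⟨g, by rw [hg, MulOpposite.op_unop]⟩
  -- `Sℓ ≃ Sℓ.map d = St.op ≃ Stᵐᵒᵖ`, and `Stᵐᵒᵖ` is semisimple
  have e : ↥Sℓ ≃ₐ[ℚ_[ℓ]] (↥St)ᵐᵒᵖ :=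
    ((Subalgebra.equivMapOfInjective Sℓ d hdinj).trans (Subalgebra.equivOfEq _ _ hmap)).trans St.mopAlgEquivOp.symm
  haveI : IsSemisimpleRing (↥St)ᵐᵒᵖ := inferInstance
  exact RingEquiv.isSemisimpleRing (R := (↥St)ᵐᵒᵖ) (S := ↥Sℓ) e.symm.toRingEquiv

/-- **DH2b, door (β) — the image of the Hecke algebra in `End⁰(A_K)` is semisimple if `H¹_ét(A_K)` is a semisimple Hecke module.**  Precisely (the
cell's S1 clause (3), text of record): if `H¹_ét(A_K) = (V_ℓ A_K)^∨` is a semisimple module over the `ℚ_ℓ`-subalgebra of `End(H¹_ét(A_K))` generated by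
the Hecke operators `[KgK] = ᵗ(V_ℓ^ℚ heckeEnd K g)` (★ `toTower_dualMap_rationalTateAction_heckeEnd`), then `heckeImage` is a semisimple ring.
(«… isomorphisms … of `C_c^∞(K\G(𝔸^∞)/K, ℚ)`-modules» (D.3) ⇒ the image is semisimple: faithful semisimple module, transpose, then descent
`ℚ_ℓ/ℚ`.) [cite: Liu2021, p. 133 (before and at (D.3))] [cite: MumfordAV1970, §19 Thm. 3] [cite: Lam2001FirstCourse, §9 Prop. (9.11) p. 146] -/
theorem isSemisimpleRing_heckeImage_of_isSemisimpleModule (hD : T.IsogenyDescent) (K : C5.SmallLevel C.S.K₀)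
    (hss : IsSemisimpleModule
      ↥(Algebra.adjoin ℚ_[ℓ] (Set.range fun g : C.G => (rationalTateAction (C.A K) ℓ (T.heckeEnd hD K g)).dualMap))
      (C.etaleH1 ℓ K)) :
    IsSemisimpleRing ↥(T.heckeImage hD K) :=
  T.isSemisimpleRing_heckeImage_of_isSemisimpleRing_adjoin ℓ hD K
    (T.isSemisimpleRing_adjoin_rationalTateAction_of_isSemisimpleModule_etaleH1 ℓ hD K hss)

/-- The same with the hypothesis on the homology side: `V_ℓ A_K` a semisimple module over `ℚ_ℓ[V_ℓ^ℚ [KgK] : g]`.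
[cite: Liu2021, p. 133 (before and at (D.3))] [cite: Lam2001FirstCourse, §9 Prop. (9.11) p. 146] -/
theorem isSemisimpleRing_heckeImage_of_isSemisimpleModule_tateModule (hD : T.IsogenyDescent) (K : C5.SmallLevel C.S.K₀)
    (hss : IsSemisimpleModule
      ↥(Algebra.adjoin ℚ_[ℓ] (Set.range fun g : C.G => rationalTateAction (C.A K) ℓ (T.heckeEnd hD K g)))
      ((C.A K).rationalTateModule ℓ)) :
    IsSemisimpleRing ↥(T.heckeImage hD K) := by
  have hℓE : (ℓ : E) ≠ 0 := natCast_ne_zero' ℓ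
  haveI : Module.Finite ℚ_[ℓ] ((C.A K).rationalTateModule ℓ) := by
    haveI := Literature.AlgebraicGeometry.Motives.AbelianVariety.module_finite_tateModule_of_cast_ne_zero (C.A K) ℓ hℓE
    change Module.Finite ℚ_[ℓ] (ℚ_[ℓ] ⊗[ℤ_[ℓ]] (C.A K).tateModule ℓ)
    infer_instance
  exact T.isSemisimpleRing_heckeImage_of_isSemisimpleRing_adjoin ℓ hD K
    (Literature.RingTheory.SimpleModule.isSemisimpleRing_of_isSemisimpleModule _)

end Sec42Data.HeckeTranslates

end Literature.NumberTheory.Automorphic.Liu2021.AppendixC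

end
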